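import Summits.BirchSwinnertonDyer.BirchSwinnertonDyer.Theorems.GoldfeldAllTwistsTwoConverseTwinQuarterTraceCosetDifference
import Summits.BirchSwinnertonDyer.BirchSwinnertonDyer.Theorems.GoldfeldAllTwistsTwoConverseTwinQuarterTraceTorsion
import HarnessLib

set_option linter.dupNamespace false -- namespace `…BirchSwinnertonDyer.BirchSwinnertonDyer…` is the cell's (D-0017 nested layout)
set_option autoImplicit false

/-!
# LINE B⁗, file X5-prep: three fact-free preliminaries of the χ_Z assembly — the lift `σ̃_p ∈ Gal(L/K)` fixing `r_q` and negating `r_p`,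
# odd killers of torsion in `X₀(49)(F)` into `{O, T}`, and the explicit QUARTER POINT `Z = N•Ψ − N_e•R_e − N_q•Y − N_p•R_p`

Cell `bsd-goldfeld`, seat `bsd-goldfeld-s1p-c3x` (gen 10); planner ORDER (cccviii) «LINE B⁗ — TRANCHE 2 closer», the announced split of
X5β-χ (serves X5α too). `--supports stmt-BirchSwinnertonDyer-19140` as a HELPER (twin″). FACT-FREE: no print binder, no definition,
no `sorry`; pure field theory / group bookkeeping.

* §1 `exists_algEquiv_apply_sqrt_eq_self_and_eq_neg`: in a finite Galois extension `L/K` with `r_q² = a`, `r_p² = b` (`a, b ∈ K`), if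
  `b ∉ K²` and `ab ∉ K²` then some `σ ∈ Gal(L/K)` has `σr_q = r_q` and `σr_p = −r_p` (take `σ₂` negating `r_p`; if it moves `r_q`,
  compose with a `σ₃` negating `r_qr_p`). For `K = ℚ(√−2qp) ⊂ L = K[1]`, `a = −q`, `b = p` this is the lift `σ̃_p` of the genus
  automorphism `σ_p` (`p, −qp ∉ K²`: `…TwinQuarterTraceGalois`).
* §2 `cm7_exists_odd_zsmul_mem_pair`, `zsmul_mem_pair`, `add_mem_pair`: odd killers of torsion points of `X₀(49)(F)` (`±7 ∉ F²`) into
  `{O, T}`, and closure of `{O, T}` under `ℤ`-multiples and sums.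
* §3 `four_zsmul_quarterPoint`: from `4Ψ = y + P_e + P_q + P_p` and the three package relations `M_e•P_e = 4•R_e + t_e`,
  `M_q•P_q = (4m)•Y + t_q`, `M_p•P_p = 4•R_p + t_p` with odd killers of `t_e, t_q, t_p` into `{0, T}`: an odd `n₀` and `t ∈ {0, T}` with
  `4•(N•Ψ − N_e•R_e − N_q•Y − N_p•R_p) = N•y + t`, `N = n₀M_eM_qM_p`, `N_e = n₀M_qM_p`, `N_q = n₀M_eM_p·m`, `N_p = n₀M_eM_q`
  (Halving's `exists_quarterPoint_of_packages` with the SHAPE of `Z` exported, as X4's `exists_odd_zsmul_map_sub_eq_twoTorsion` wants it).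

References: [Gross1984] §4; [GrossLMS1991] Prop. 5.3; [Cox2013] §6.A Thm 6.1; [SilvermanTate2015] §3.5.
-/

noncomputable section

open scoped Classical

open WeierstrassCurve Literature.NumberTheory.EllipticCurves

namespace Summit.BirchSwinnertonDyer.BirchSwinnertonDyer.Theorems.GoldfeldGoodTwists

/-! ## §1 The lift `σ̃_p`: an automorphism fixing `r_q` and negating `r_p` -/
section Lift
variable {K : Type} [Field K] {L : Type} [Field L] [CharZero L] [Algebra K L] [FiniteDimensional K L] [IsGalois K L]

/-- **The lift `σ̃_p`.** If `r_q² = a`, `r_p² = b` with `b ∉ K²` and `ab ∉ K²`, some `σ ∈ Gal(L/K)` fixes `r_q` and negates `r_p`.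
[cite: Cox2013, §6.A Thm. 6.1] -/
theorem exists_algEquiv_apply_sqrt_eq_self_and_eq_neg {rq rp : L} {a b : K} (hrq : rq ^ 2 = algebraMap K L a)
    (hrp : rp ^ 2 = algebraMap K L b) (hb : ¬ IsSquare b) (hab : ¬ IsSquare (a * b)) :
    ∃ σ : L ≃ₐ[K] L, σ rq = rq ∧ σ rp = -rp := by
  have hre : (rq * rp) ^ 2 = algebraMap K L (a * b) := by rw [mul_pow, hrq, hrp, map_mul]
  have hrp0 : rp ≠ 0 := by
    rintro rfl
    apply hb
    have hb0 : algebraMap K L b = 0 := by rw [← hrp, zero_pow two_ne_zero]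
    rw [(algebraMap K L).injective (hb0.trans (map_zero _).symm)]
    exact ⟨0, (mul_zero 0).symm⟩
  have hrq0 : rq ≠ 0 := by
    rintro rfl
    apply hab
    have ha0 : algebraMap K L a = 0 := by rw [← hrq, zero_pow two_ne_zero]
    rw [(algebraMap K L).injective (ha0.trans (map_zero _).symm), zero_mul]
    exact ⟨0, (mul_zero 0).symm⟩
  obtain ⟨σ₂, h₂⟩ := exists_algEquiv_apply_sqrt_eq_neg hrp hb
  rcases algEquiv_apply_sqrt_eq_or hrq σ₂ with h | h
  · exact ⟨σ₂, h, h₂⟩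
  obtain ⟨σ₃, h₃⟩ := exists_algEquiv_apply_sqrt_eq_neg hre hab
  rw [map_mul] at h₃
  rcases algEquiv_apply_sqrt_eq_or hrq σ₃ with hq₃ | hq₃ <;> rcases algEquiv_apply_sqrt_eq_or hrp σ₃ with hp₃ | hp₃
  · exact absurd (by rw [hq₃, hp₃] at h₃; linear_combination h₃) (mul_ne_zero (mul_ne_zero two_ne_zero hrq0) hrp0)
  · exact ⟨σ₃, hq₃, hp₃⟩
  · refine ⟨σ₂ * σ₃, ?_, ?_⟩
    · rw [AlgEquiv.mul_apply, hq₃, map_neg, h, neg_neg]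
    · rw [AlgEquiv.mul_apply, hp₃, h₂]
  · exact absurd (by rw [hq₃, hp₃] at h₃; linear_combination h₃) (mul_ne_zero (mul_ne_zero two_ne_zero hrq0) hrp0)

end Lift

/-! ## §2 Odd killers into `{O, T}` and the closure of `{O, T}` -/
section Pair
variable {M : Type*} [AddCommGroup M]

/-- `{0, T}` (`2T = 0`) is closed under integer multiples. [folklore] -/
theorem zsmul_mem_pair {T : M} (hT2 : 2 • T = 0) {X : M} (h : X = 0 ∨ X = T) (c : ℤ) : c • X = 0 ∨ c • X = T := by
  rcases h with rfl | rfl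
  · exact Or.inl (zsmul_zero c)
  · rcases Int.even_or_odd c with ⟨j, rfl⟩ | hc
    · left; rw [← two_mul, mul_comm, ← smul_smul, two_zsmul, ← two_nsmul, hT2, zsmul_zero]
    · exact Or.inr (zsmul_twoTorsion_of_odd hT2 hc)

/-- `{0, T}` (`2T = 0`) is closed under sums. [folklore] -/
theorem add_mem_pair {T : M} (hT2 : 2 • T = 0) {X Y : M} (hX : X = 0 ∨ X = T) (hY : Y = 0 ∨ Y = T) : X + Y = 0 ∨ X + Y = T := by
  rcases hX with rfl | rfl <;> rcases hY with rfl | rfl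
  · exact Or.inl (add_zero 0)
  · exact Or.inr (zero_add _)
  · exact Or.inr (add_zero _)
  · left; rw [← two_nsmul, hT2]

end Pair

section Torsion
variable {F : Type*} [Field F] [CharZero F]

/-- **Odd killers into `{O, T}`** (`ℤ`-version of `cm7_exists_odd_nsmul_mem_pair`): for `±7 ∉ F²` every torsion point `u` of `X₀(49)(F)`
has an odd `k ∈ ℤ` with `k•u ∈ {O, T}`. [cite: SilvermanTate2015, §3.5] -/
theorem cm7_exists_odd_zsmul_mem_pair (h7 : ¬ IsSquare (-7 : F)) (h7' : ¬ IsSquare (7 : F))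
    {u : (cm7.baseChange F).toAffine.Point} (hu : IsOfFinAddOrder u) :
    ∃ k : ℤ, Odd k ∧ (k • u = 0 ∨ k • u = Affine.Point.some 2 (-1) (nonsingular_cm7_baseChange_two_neg_one F)) := by
  obtain ⟨n, hn, h⟩ := cm7_exists_odd_nsmul_mem_pair h7 h7' hu
  exact ⟨n, (Int.odd_coe_nat n).mpr hn, by rw [natCast_zsmul]; exact h⟩

end Torsion

/-! ## §3 The explicit quarter point -/
section Quarter
variable {M : Type*} [AddCommGroup M]

/-- **The quarter point, with its shape.** From `4Ψ = y + P_e + P_q + P_p`, `M_e•P_e = 4•R_e + t_e`, `M_q•P_q = (4m)•Y + t_q`,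
`M_p•P_p = 4•R_p + t_p` and odd killers of `t_e, t_q, t_p` into `{0, T}` (`2T = 0`): an odd `n₀` and `t ∈ {0, T}` with
`4 • (N•Ψ − N_e•R_e − N_q•Y − N_p•R_p) = N•y + t` for `N = n₀M_eM_qM_p`, `N_e = n₀M_qM_p`, `N_q = n₀M_eM_p m`, `N_p = n₀M_eM_q`.
[cite: GrossLMS1991, Prop. 5.3] [cite: CoatesLiTianZhai2015, Thm. 2.5 (the half-trace device)] -/
theorem four_zsmul_quarterPoint {T : M} (hT2 : 2 • T = 0) {Ψ y Pe Pq Pp Y Re Rp te tq tp : M} {m Me Mq Mp : ℤ}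
    (hΨ : (4 : ℤ) • Ψ = y + Pe + Pq + Pp) (hPe : Me • Pe = (4 : ℤ) • Re + te) (hPq : Mq • Pq = (4 * m) • Y + tq)
    (hPp : Mp • Pp = (4 : ℤ) • Rp + tp) (hte : ∃ k : ℤ, Odd k ∧ (k • te = 0 ∨ k • te = T))
    (htq : ∃ k : ℤ, Odd k ∧ (k • tq = 0 ∨ k • tq = T)) (htp : ∃ k : ℤ, Odd k ∧ (k • tp = 0 ∨ k • tp = T)) :
    ∃ (n₀ : ℤ) (t : M), Odd n₀ ∧ (t = 0 ∨ t = T) ∧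
      (4 : ℤ) • ((n₀ * (Me * Mq * Mp)) • Ψ - (n₀ * (Mq * Mp)) • Re - (n₀ * (Me * Mp) * m) • Y - (n₀ * (Me * Mq)) • Rp) =
        (n₀ * (Me * Mq * Mp)) • y + t := by
  obtain ⟨ke, hke, hkeu⟩ := hte
  obtain ⟨kq, hkq, hkqu⟩ := htq
  obtain ⟨kp, hkp, hkpu⟩ := htp
  refine ⟨ke * kq * kp, (kq * kp * (Mq * Mp)) • (ke • te) + (ke * kp * (Me * Mp)) • (kq • tq) + (ke * kq * (Me * Mq)) • (kp • tp),
    (hke.mul hkq).mul hkp, ?_, ?_⟩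
  · exact add_mem_pair hT2 (add_mem_pair hT2 (zsmul_mem_pair hT2 hkeu _) (zsmul_mem_pair hT2 hkqu _)) (zsmul_mem_pair hT2 hkpu _)
  · rw [smul_smul, smul_smul, smul_smul]
    linear_combination (norm := module) (ke * kq * kp * (Me * Mq * Mp)) • hΨ + (ke * kq * kp * (Mq * Mp)) • hPe +
      (ke * kq * kp * (Me * Mp)) • hPq + (ke * kq * kp * (Me * Mq)) • hPp

end Quarter

end Summit.BirchSwinnertonDyer.BirchSwinnertonDyer.Theorems.GoldfeldGoodTwists

end
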